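import Summits.AtomisticToContinuum.HydrodynamicLimit.Theorems.JParityClosureLocalSecondLawContactDefs
import Summits.AtomisticToContinuum.HydrodynamicLimit.Theorems.JParityClosureLocalSecondLawLedgerHonestA
import Summits.AtomisticToContinuum.HydrodynamicLimit.Theorems.BoltzmannGreenKubo.Negative.JointMeasurability
import Summits.AtomisticToContinuum.HydrodynamicLimit.Theorems.LocalSecondLaw.Negative.EquilibriumL1

/-!
# Pinned cells: the conditioned law and its mean coarse fields
(crux `JParityClosure.LocalSecondLaw`, stmt-AtomisticToContinuum-13081, line `contact-asymmetry-information`,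
stub Q `stub_pinnedRepresentation` — measure-theoretic layer)

Junk/measurability audit of the objects of stub Q, as theorems.  For an ARBITRARY (possibly non-measurable)
cell `S` of a measure `μ` on phase space with `0 < μ S < ∞`:
* `condLaw μ S = (μ S)⁻¹ • μ|_S` is a probability measure (`isProbabilityMeasure_condLaw`), and every
  `μ`-null set is `condLaw`-null (`condLaw_null`);
* a MEASURABLE predicate that holds on `S` holds `condLaw μ S`-almost everywhere (`ae_condLaw_of_forall_mem`:
  `ae_restrict_iff` needs measurability of the predicate, not of `S` — for a non-measurable `S` the restricted
  measure lives on the measurable hull `toMeasurable μ S`, so `∀ᵐ z ∂μ|_S, z ∈ S` may FAIL, but the pinning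
  predicates `|ρ_r(Φₛz)(x) − a| ≤ η′` are closed conditions on the continuous coarse fields composed with the
  measurable time-`s` flow map, hence measurable);
* consequently the coarse fields of the flow are integrable under the conditioned law of a pinned cell with NO
  moment hypothesis (pinning bounds them on `S`), and **means of pinned quantities are pinned**
  (`contactQ_mean_pinned`, registered sub-lemma of stub Q): if `S ⊆ Pin σ r τ η′ Φ c` then the mean coarse
  fields `(ρ̄, m̄, ē)` of `condLaw μ S` are within `η′` of the centre `c` on `[0, τ] × 𝕋³`, whence every member
  of the cell has its coarse history within `2η′` of the mean history (`contactQ_fields_close`, and in the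
  sup-distance of the conserved variables `pinQ_dist_U_le`);
* the mean fields are continuous in the field point (dominated convergence; for `m̄, ē` when the speeds are a.e.
  bounded along the orbit, `continuous_rhoBar/momBar/kinBar`) and jointly measurable in `(s, x)` for laws carried by
  the good set (Fubini measurability after the jointly measurable modified flow `flowMod`, `measurable_rhoBar₂` etc.),
  and the mean temperature is the temperature of the mean conserved variables (`pinQ_thetaBar_eq`).

References: H. Spohn, *Large Scale Dynamics of Interacting Particles* (1991), Part I §3 (coarse fields of the
local Gibbs law); elementary measure theory (Bochner integral against a normalised restriction).
-/

noncomputable section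

open scoped BigOperators Topology Classical MeasureTheory ENNReal InnerProductSpace
open Filter Set MeasureTheory Function
open Literature.MathematicalPhysics.KineticTheory
open Literature.Analysis.FluidPDE
open Summit.AtomisticToContinuum.HydrodynamicLimit.Theorems.LocalSecondLawNegative
open Summit.AtomisticToContinuum.HydrodynamicLimit.Theorems.LocalSecondLawLedger

namespace Summit.AtomisticToContinuum.HydrodynamicLimit.Theorems.LocalSecondLawContact

variable {N : ℕ}

/-! ## The conditioned law -/

/-- The conditioned law of a cell of positive finite mass is a probability measure. -/
theorem isProbabilityMeasure_condLaw {μ : Measure (Phase N)} {S : Set (Phase N)} (h0 : μ S ≠ 0)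
    (htop : μ S ≠ ⊤) : IsProbabilityMeasure (condLaw μ S) :=
  ⟨by rw [condLaw, Measure.smul_apply, Measure.restrict_apply_univ, smul_eq_mul, ENNReal.inv_mul_cancel h0 htop]⟩

/-- `μ`-null sets are null for the conditioned law (whatever the cell). -/
theorem condLaw_null {μ : Measure (Phase N)} (S : Set (Phase N)) {T : Set (Phase N)} (hT : μ T = 0) :
    condLaw μ S T = 0 := by
  rw [condLaw, Measure.smul_apply, smul_eq_mul]
  have h : μ.restrict S T ≤ 0 := (Measure.le_iff'.1 Measure.restrict_le_self T).trans hT.le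
  rw [nonpos_iff_eq_zero.1 h, mul_zero]

/-- A MEASURABLE predicate holding on the cell holds almost everywhere for the conditioned law (no measurability
of the cell is needed). -/
theorem ae_condLaw_of_forall_mem {μ : Measure (Phase N)} {S : Set (Phase N)} {p : Phase N → Prop}
    (hp : MeasurableSet {z | p z}) (h : ∀ z ∈ S, p z) : ∀ᵐ z ∂condLaw μ S, p z := by
  rw [condLaw]
  exact Measure.ae_smul_measure ((ae_restrict_iff hp).2 (Eventually.of_forall h)) _

/-- A measurable superset of the cell carries the conditioned law. -/
theorem ae_mem_condLaw_of_subset {μ : Measure (Phase N)} {S T : Set (Phase N)} (hT : MeasurableSet T)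
    (h : S ⊆ T) : ∀ᵐ z ∂condLaw μ S, z ∈ T :=
  ae_condLaw_of_forall_mem (p := fun z => z ∈ T) hT h

/-! ## Measurability of the coarse fields of the flow -/

/-- The coarse momentum is jointly continuous in (configuration, field point), as a vector. -/
theorem continuous_momC_vec {r : ℝ} (hr : 0 < r) : Continuous fun p : Phase N × T3 => momC r p.1 p.2 := by
  have h : (fun p : Phase N × T3 => momC r p.1 p.2) =
      fun p => ((N + 1 : ℕ) : ℝ)⁻¹ • ∑ i : Fin (N + 1), cone r (p.1 i).1 p.2 • (p.1 i).2 :=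
    funext fun p => L.momC_eq_sum r p.1 p.2
  rw [h]
  exact (continuous_const (y := ((N + 1 : ℕ) : ℝ)⁻¹)).smul (continuous_finsetSum _ fun i _ =>
    (L.continuous_cone₂ hr i).smul (continuous_snd.comp ((continuous_apply i).comp continuous_fst)))

/-- The coarse density of the time-`s` configuration is a measurable function of the initial phase point. -/
theorem measurable_rhoC_flow {r : ℝ} (hr : 0 < r) {σ : ℝ} (Φ : Flow σ N) (s : ℝ) (x : T3) :
    Measurable fun z => rhoC r (Φ.flow s z) x := by
  have h : Measurable fun w : Phase N => rhoC r w x :=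
    ((L.continuous_rhoC₂ (N := N) hr).comp (continuous_id.prodMk continuous_const)).measurable
  exact (h.comp (Φ.measurable_flow s) :)

/-- The coarse momentum of the time-`s` configuration is a measurable function of the initial phase point. -/
theorem measurable_momC_flow {r : ℝ} (hr : 0 < r) {σ : ℝ} (Φ : Flow σ N) (s : ℝ) (x : T3) :
    Measurable fun z => momC r (Φ.flow s z) x := by
  have h : Measurable fun w : Phase N => momC r w x :=
    ((continuous_momC_vec (N := N) hr).comp (continuous_id.prodMk continuous_const)).measurable
  exact (h.comp (Φ.measurable_flow s) :)

/-- The coarse kinetic energy of the time-`s` configuration is a measurable function of the initial phase point. -/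
theorem measurable_kinC_flow {r : ℝ} (hr : 0 < r) {σ : ℝ} (Φ : Flow σ N) (s : ℝ) (x : T3) :
    Measurable fun z => kinC r (Φ.flow s z) x := by
  have h : Measurable fun w : Phase N => kinC r w x :=
    ((L.continuous_kinC₂ (N := N) hr).comp (continuous_id.prodMk continuous_const)).measurable
  exact (h.comp (Φ.measurable_flow s) :)

/-! ## Means of pinned quantities are pinned -/

/-- Abstract form: the mean of an a.e. strongly measurable vector observable that is a.e. within `η′` of a
constant `a` under a probability measure is within `η′` of `a` (the observable is then integrable). -/
theorem norm_integral_sub_le_of_ae {E : Type*} [NormedAddCommGroup E] [NormedSpace ℝ E] [CompleteSpace E]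
    {ν : Measure (Phase N)} [IsProbabilityMeasure ν] {f : Phase N → E} (hf : AEStronglyMeasurable f ν)
    {a : E} {η' : ℝ} (h : ∀ᵐ z ∂ν, ‖f z - a‖ ≤ η') : ‖(∫ z, f z ∂ν) - a‖ ≤ η' := by
  have hfi : Integrable f ν := by
    refine Integrable.mono' (integrable_const (‖a‖ + η')) hf ?_
    filter_upwards [h] with z hz
    calc ‖f z‖ = ‖(f z - a) + a‖ := by rw [sub_add_cancel]
      _ ≤ ‖f z - a‖ + ‖a‖ := norm_add_le _ _
      _ ≤ ‖a‖ + η' := by linarith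
  have hsub : (∫ z, f z ∂ν) - a = ∫ z, (f z - a) ∂ν := by
    rw [integral_sub hfi (integrable_const a), integral_const, probReal_univ, one_smul]
  rw [hsub]
  have h1 := norm_integral_le_of_norm_le_const h
  rwa [probReal_univ, mul_one] at h1

/-- **Registered sub-lemma `contactQ_mean_pinned` of stub Q** (`stub_pinnedRepresentation`, line
`contact-asymmetry-information`): on a pinned cell `S ⊆ Pin σ r τ η′ Φ c` of positive finite mass the MEAN coarse
fields of the conditioned law are pinned to the same centre at the same resolution, on all of `[0, τ] × 𝕋³`.
No measurability of `S` and no moment hypothesis is needed. -/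
theorem contactQ_mean_pinned : ∀ {N : ℕ} (σ r τ η' : ℝ), 0 < r → ∀ (Φ : Flow σ N) (c : Centre) (μ : Measure (Phase N)) (S : Set (Phase N)), μ S ≠ 0 → μ S ≠ ⊤ → S ⊆ Pin σ r τ η' Φ c → ∀ s ∈ Set.Icc (0 : ℝ) τ, ∀ x : T3, |rhoBar r (condLaw μ S) Φ s x - (c s x).1| ≤ η' ∧ ‖momBar r (condLaw μ S) Φ s x - (c s x).2.1‖ ≤ η' ∧ |kinBar r (condLaw μ S) Φ s x - (c s x).2.2| ≤ η' := by
  intro N σ r τ η' hr Φ c μ S h0 htop hS s hs x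
  haveI := isProbabilityMeasure_condLaw h0 htop
  have hpin : ∀ z ∈ S, |rhoC r (Φ.flow s z) x - (c s x).1| ≤ η' ∧ ‖momC r (Φ.flow s z) x - (c s x).2.1‖ ≤ η' ∧
      |kinC r (Φ.flow s z) x - (c s x).2.2| ≤ η' := fun z hz => hS hz s hs x
  refine ⟨?_, ?_, ?_⟩
  · have hm := measurable_rhoC_flow hr Φ s x
    have hae : ∀ᵐ z ∂condLaw μ S, ‖rhoC r (Φ.flow s z) x - (c s x).1‖ ≤ η' :=
      ae_condLaw_of_forall_mem (measurableSet_le (hm.sub_const _).norm measurable_const)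
        fun z hz => by rw [Real.norm_eq_abs]; exact (hpin z hz).1
    have h := norm_integral_sub_le_of_ae hm.aestronglyMeasurable hae
    rwa [Real.norm_eq_abs] at h
  · have hm := measurable_momC_flow hr Φ s x
    have hae : ∀ᵐ z ∂condLaw μ S, ‖momC r (Φ.flow s z) x - (c s x).2.1‖ ≤ η' :=
      ae_condLaw_of_forall_mem (measurableSet_le (hm.sub_const _).norm measurable_const)
        fun z hz => (hpin z hz).2.1
    exact norm_integral_sub_le_of_ae hm.aestronglyMeasurable hae
  · have hm := measurable_kinC_flow hr Φ s x
    have hae : ∀ᵐ z ∂condLaw μ S, ‖kinC r (Φ.flow s z) x - (c s x).2.2‖ ≤ η' :=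
      ae_condLaw_of_forall_mem (measurableSet_le (hm.sub_const _).norm measurable_const)
        fun z hz => by rw [Real.norm_eq_abs]; exact (hpin z hz).2.2
    have h := norm_integral_sub_le_of_ae hm.aestronglyMeasurable hae
    rwa [Real.norm_eq_abs] at h

/-- **Every member of a pinned cell has its coarse history within `2η′` of the MEAN history of the conditioned
law**, uniformly on `[0, τ] × 𝕋³`. -/
theorem contactQ_fields_close {σ r τ η' : ℝ} (hr : 0 < r) {Φ : Flow σ N} {c : Centre} {μ : Measure (Phase N)}
    {S : Set (Phase N)} (h0 : μ S ≠ 0) (htop : μ S ≠ ⊤) (hS : S ⊆ Pin σ r τ η' Φ c) {z : Phase N} (hz : z ∈ S)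
    {s : ℝ} (hs : s ∈ Set.Icc (0 : ℝ) τ) (x : T3) :
    |rhoC r (Φ.flow s z) x - rhoBar r (condLaw μ S) Φ s x| ≤ 2 * η' ∧
      ‖momC r (Φ.flow s z) x - momBar r (condLaw μ S) Φ s x‖ ≤ 2 * η' ∧
        |kinC r (Φ.flow s z) x - kinBar r (condLaw μ S) Φ s x| ≤ 2 * η' := by
  obtain ⟨h1, h2, h3⟩ := contactQ_mean_pinned σ r τ η' hr Φ c μ S h0 htop hS s hs x
  obtain ⟨g1, g2, g3⟩ := hS hz s hs x
  refine ⟨?_, ?_, ?_⟩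
  · have := abs_sub_le (rhoC r (Φ.flow s z) x) (c s x).1 (rhoBar r (condLaw μ S) Φ s x)
    rw [abs_sub_comm ((c s x).1)] at this
    linarith
  · have := norm_sub_le_norm_sub_add_norm_sub (momC r (Φ.flow s z) x) (c s x).2.1 (momBar r (condLaw μ S) Φ s x)
    rw [norm_sub_rev ((c s x).2.1)] at this
    linarith
  · have := abs_sub_le (kinC r (Φ.flow s z) x) (c s x).2.2 (kinBar r (condLaw μ S) Φ s x)
    rw [abs_sub_comm ((c s x).2.2)] at this
    linarith

/-! ## Bounds, continuity and joint measurability of the mean fields -/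

/-- The coarse momentum is bounded in norm on the bounded-velocity box. -/
theorem pinQ_norm_momC_le {r V : ℝ} (hr : 0 < r) {w : Phase N} (hw : w ∈ L.KV N V) (x : T3) :
    ‖momC r w x‖ ≤ 3 / (Real.pi * r ^ 3) * V := by
  rw [L.momC_eq_sum, norm_smul, Real.norm_eq_abs, abs_of_nonneg (by positivity)]
  have hN : (0 : ℝ) < ((N + 1 : ℕ) : ℝ) := by positivity
  calc ((N + 1 : ℕ) : ℝ)⁻¹ * ‖∑ i, cone r (w i).1 x • (w i).2‖
      ≤ ((N + 1 : ℕ) : ℝ)⁻¹ * ∑ i, ‖cone r (w i).1 x • (w i).2‖ :=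
        mul_le_mul_of_nonneg_left (norm_sum_le _ _) (by positivity)
    _ ≤ ((N + 1 : ℕ) : ℝ)⁻¹ * ∑ _i : Fin (N + 1), 3 / (Real.pi * r ^ 3) * V := by
        refine mul_le_mul_of_nonneg_left (Finset.sum_le_sum fun i _ => ?_) (by positivity)
        rw [norm_smul, Real.norm_eq_abs]
        exact mul_le_mul (L.abs_cone_le hr _ _) (hw i) (norm_nonneg _) (by positivity)
    _ = 3 / (Real.pi * r ^ 3) * V := by
        rw [Finset.sum_const, Finset.card_univ, Fintype.card_fin, nsmul_eq_mul]; field_simp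

section MeanFields

variable {σ r : ℝ} (hr : 0 < r) (Φ : Flow σ N) (ν : Measure (Phase N)) [IsFiniteMeasure ν]
include hr

/-- The mean coarse density is continuous in the field point (dominated convergence). -/
theorem continuous_rhoBar (s : ℝ) : Continuous fun x => rhoBar r ν Φ s x := by
  show Continuous fun x => ∫ z, rhoC r (Φ.flow s z) x ∂ν
  refine continuous_of_dominated (F := fun x z => rhoC r (Φ.flow s z) x) (bound := fun _ => 3 / (Real.pi * r ^ 3))
    (fun x => (measurable_rhoC_flow hr Φ s x).aestronglyMeasurable)
    (fun x => Eventually.of_forall fun z => ?_) (integrable_const _)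
    (Eventually.of_forall fun z => LocalSecondLawNegative.continuous_rhoC (N := N) r (Φ.flow s z))
  rw [Real.norm_eq_abs, abs_of_nonneg (rhoC_nonneg hr _ _)]
  exact rhoC_le_const hr _ _

/-- The mean coarse momentum is continuous in the field point when speeds are a.e. bounded along the orbit. -/
theorem continuous_momBar (s : ℝ) {V : ℝ} (hae : ∀ᵐ z ∂ν, Φ.flow s z ∈ L.KV N V) :
    Continuous fun x => momBar r ν Φ s x := by
  show Continuous fun x => ∫ z, momC r (Φ.flow s z) x ∂ν
  have hcont : ∀ z, Continuous fun x => momC r (Φ.flow s z) x := fun z =>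
    ((continuous_momC_vec (N := N) hr).comp ((continuous_const (y := Φ.flow s z)).prodMk continuous_id) :)
  refine continuous_of_dominated (F := fun x z => momC r (Φ.flow s z) x) (bound := fun _ => 3 / (Real.pi * r ^ 3) * V)
    (fun x => (measurable_momC_flow hr Φ s x).aestronglyMeasurable) (fun x => ?_) (integrable_const _)
    (Eventually.of_forall hcont)
  filter_upwards [hae] with z hz
  exact pinQ_norm_momC_le hr hz x

/-- The mean coarse kinetic energy is continuous in the field point when speeds are a.e. bounded along the orbit. -/
theorem continuous_kinBar (s : ℝ) {V : ℝ} (hae : ∀ᵐ z ∂ν, Φ.flow s z ∈ L.KV N V) :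
    Continuous fun x => kinBar r ν Φ s x := by
  show Continuous fun x => ∫ z, kinC r (Φ.flow s z) x ∂ν
  refine continuous_of_dominated (F := fun x z => kinC r (Φ.flow s z) x)
    (bound := fun _ => 3 / (Real.pi * r ^ 3) * (V ^ 2 / 2))
    (fun x => (measurable_kinC_flow hr Φ s x).aestronglyMeasurable) (fun x => ?_) (integrable_const _)
    (Eventually.of_forall fun z => continuous_kinC (N := N) r (Φ.flow s z))
  filter_upwards [hae] with z hz
  rw [Real.norm_eq_abs]
  exact (L.kinC_box hr hz).2 x

omit [IsFiniteMeasure ν] in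
/-- The mean coarse density is jointly measurable in (time, field point) for laws carried by the good set. -/
theorem measurable_rhoBar₂ [SFinite ν] (hν : ν Φ.goodᶜ = 0) : Measurable fun q : ℝ × T3 => rhoBar r ν Φ q.1 q.2 := by
  have h1 : Measurable fun y : (ℝ × T3) × Phase N => BoltzmannGreenKuboOrthMomentum.flowMod Φ (y.1.1, y.2) :=
    (BoltzmannGreenKuboOrthMomentum.measurable_flowMod Φ).comp
      ((measurable_fst.comp measurable_fst).prodMk measurable_snd)
  have h2 : Measurable fun y : (ℝ × T3) × Phase N =>
      ((BoltzmannGreenKuboOrthMomentum.flowMod Φ (y.1.1, y.2), y.1.2) : Phase N × T3) :=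
    h1.prodMk (measurable_snd.comp measurable_fst)
  have hc : Measurable fun p : Phase N × T3 => rhoC r p.1 p.2 := (L.continuous_rhoC₂ (N := N) hr).measurable
  have hG : Measurable fun y : (ℝ × T3) × Phase N =>
      rhoC r (BoltzmannGreenKuboOrthMomentum.flowMod Φ (y.1.1, y.2)) y.1.2 := (hc.comp h2 :)
  have hS := hG.stronglyMeasurable.integral_prod_right' (ν := ν)
  have hae : ∀ᵐ z ∂ν, z ∈ Φ.good := by
    have := compl_mem_ae_iff.2 hν; rwa [compl_compl] at this
  have heq : (fun q : ℝ × T3 => rhoBar r ν Φ q.1 q.2) =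
      fun q => ∫ z, rhoC r (BoltzmannGreenKuboOrthMomentum.flowMod Φ (q.1, z)) q.2 ∂ν := by
    funext q
    unfold rhoBar
    refine integral_congr_ae ?_
    filter_upwards [hae] with z hz
    rw [BoltzmannGreenKuboOrthMomentum.flowMod_of_mem Φ hz]
  rw [heq]
  exact hS.measurable

omit [IsFiniteMeasure ν] in
/-- The mean coarse momentum is jointly measurable in (time, field point) for laws carried by the good set. -/
theorem measurable_momBar₂ [SFinite ν] (hν : ν Φ.goodᶜ = 0) : Measurable fun q : ℝ × T3 => momBar r ν Φ q.1 q.2 := by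
  have h1 : Measurable fun y : (ℝ × T3) × Phase N => BoltzmannGreenKuboOrthMomentum.flowMod Φ (y.1.1, y.2) :=
    (BoltzmannGreenKuboOrthMomentum.measurable_flowMod Φ).comp
      ((measurable_fst.comp measurable_fst).prodMk measurable_snd)
  have h2 : Measurable fun y : (ℝ × T3) × Phase N =>
      ((BoltzmannGreenKuboOrthMomentum.flowMod Φ (y.1.1, y.2), y.1.2) : Phase N × T3) :=
    h1.prodMk (measurable_snd.comp measurable_fst)
  have hc : Measurable fun p : Phase N × T3 => momC r p.1 p.2 := (continuous_momC_vec (N := N) hr).measurable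
  have hG : Measurable fun y : (ℝ × T3) × Phase N =>
      momC r (BoltzmannGreenKuboOrthMomentum.flowMod Φ (y.1.1, y.2)) y.1.2 := (hc.comp h2 :)
  have hS := hG.stronglyMeasurable.integral_prod_right' (ν := ν)
  have hae : ∀ᵐ z ∂ν, z ∈ Φ.good := by
    have := compl_mem_ae_iff.2 hν; rwa [compl_compl] at this
  have heq : (fun q : ℝ × T3 => momBar r ν Φ q.1 q.2) =
      fun q => ∫ z, momC r (BoltzmannGreenKuboOrthMomentum.flowMod Φ (q.1, z)) q.2 ∂ν := by
    funext q
    unfold momBar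
    refine integral_congr_ae ?_
    filter_upwards [hae] with z hz
    rw [BoltzmannGreenKuboOrthMomentum.flowMod_of_mem Φ hz]
  rw [heq]
  exact hS.measurable

omit [IsFiniteMeasure ν] in
/-- The mean coarse kinetic energy is jointly measurable in (time, field point) for laws carried by the good set. -/
theorem measurable_kinBar₂ [SFinite ν] (hν : ν Φ.goodᶜ = 0) : Measurable fun q : ℝ × T3 => kinBar r ν Φ q.1 q.2 := by
  have h1 : Measurable fun y : (ℝ × T3) × Phase N => BoltzmannGreenKuboOrthMomentum.flowMod Φ (y.1.1, y.2) :=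
    (BoltzmannGreenKuboOrthMomentum.measurable_flowMod Φ).comp
      ((measurable_fst.comp measurable_fst).prodMk measurable_snd)
  have h2 : Measurable fun y : (ℝ × T3) × Phase N =>
      ((BoltzmannGreenKuboOrthMomentum.flowMod Φ (y.1.1, y.2), y.1.2) : Phase N × T3) :=
    h1.prodMk (measurable_snd.comp measurable_fst)
  have hc : Measurable fun p : Phase N × T3 => kinC r p.1 p.2 := (L.continuous_kinC₂ (N := N) hr).measurable
  have hG : Measurable fun y : (ℝ × T3) × Phase N =>
      kinC r (BoltzmannGreenKuboOrthMomentum.flowMod Φ (y.1.1, y.2)) y.1.2 := (hc.comp h2 :)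
  have hS := hG.stronglyMeasurable.integral_prod_right' (ν := ν)
  have hae : ∀ᵐ z ∂ν, z ∈ Φ.good := by
    have := compl_mem_ae_iff.2 hν; rwa [compl_compl] at this
  have heq : (fun q : ℝ × T3 => kinBar r ν Φ q.1 q.2) =
      fun q => ∫ z, kinC r (BoltzmannGreenKuboOrthMomentum.flowMod Φ (q.1, z)) q.2 ∂ν := by
    funext q
    unfold kinBar
    refine integral_congr_ae ?_
    filter_upwards [hae] with z hz
    rw [BoltzmannGreenKuboOrthMomentum.flowMod_of_mem Φ hz]
  rw [heq]
  exact hS.measurable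

end MeanFields

/-! ## The mean conserved variables: temperature, distance to cell members -/

/-- The mean temperature is the temperature of the mean conserved variables. -/
theorem pinQ_thetaBar_eq {σ r : ℝ} (ν : Measure (Phase N)) (Φ : Flow σ N) (s : ℝ) (x : T3) :
    thetaBar r ν Φ s x = L.thetaOf (rhoBar r ν Φ s x) (kinBar r ν Φ s x) (WithLp.ofLp (momBar r ν Φ s x)) := by
  rw [L.thetaOf, thetaBar, L.norm_sq_eq_sum]

/-- The sup distance of the conserved variables of a cell member to the mean conserved variables is at most `2η′`. -/
theorem pinQ_dist_U_le {σ r τ η' : ℝ} (hr : 0 < r) {Φ : Flow σ N} {c : Centre} {μ : Measure (Phase N)}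
    {S : Set (Phase N)} (h0 : μ S ≠ 0) (htop : μ S ≠ ⊤) (hS : S ⊆ Pin σ r τ η' Φ c) {z : Phase N} (hz : z ∈ S)
    {s : ℝ} (hs : s ∈ Set.Icc (0 : ℝ) τ) (x : T3) :
    dist (L.U r (Φ.flow s z) x)
      ((rhoBar r (condLaw μ S) Φ s x, WithLp.ofLp (momBar r (condLaw μ S) Φ s x), kinBar r (condLaw μ S) Φ s x) : L.CV)
        ≤ 2 * η' := by
  obtain ⟨h1, h2, h3⟩ := contactQ_fields_close hr h0 htop hS hz hs x
  have hη : 0 ≤ 2 * η' := (abs_nonneg _).trans h1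
  rw [L.U, Prod.dist_eq, max_le_iff, Prod.dist_eq, max_le_iff, Real.dist_eq, Real.dist_eq]
  refine ⟨h1, ?_, h3⟩
  refine (dist_pi_le_iff hη).2 fun k => ?_
  rw [Real.dist_eq]
  have := PiLp.norm_apply_le (momC r (Φ.flow s z) x - momBar r (condLaw μ S) Φ s x) k
  rw [Real.norm_eq_abs] at this
  exact this.trans h2

end Summit.AtomisticToContinuum.HydrodynamicLimit.Theorems.LocalSecondLawContact

end
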